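import Summits.Ventures.CertifiedManyBodySolver.Rows.HubbardChainMPSRaw5TrNodesSrot
import Summits.Ventures.CertifiedManyBodySolver.Transport.MPSPrimalRaw6SrotNszb
import Summits.Ventures.CertifiedManyBodySolver.Transport.ChainWindowSpinRotationRowsNszb
import HarnessLib

/-!
# Ventures/CertifiedManyBodySolver — Rows/HubbardChainMPSRaw6TrNodesNszb.lean: the `jw-srot` RAWLOW node with raw block `ρ₆` and STAGGERED
# CHARGE COMPONENTS (FORMAT-ksdn v0.5 `mps-rawlow` + v0.6 'staggered charge components', χ12 `nszb`: `m₀ = 7`, injection `W₅`, `lmax_psd`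
# trace bounds, bond labels a pair) and its solver-free edges

HONEST FRAMING: first certified bounds; not a superconductivity verdict; every number certified or labelled float.

Speedrun cell sr-mbsolver / programme hubbard-alg, LIT team (lit-1 gen-18), T3″ of `HOME/sr-mbsolver-lit-1/lean/g16/READY-LEAN-355.md` (re-planned
without the twirl: `HOME/sr-mbsolver-lit-1/tools/g18/READY-FOLDS-g18.md` §F) — the CLAIM-NODE SHAPE for the BY-VALUE Lean cells of the χ12 `nszb`
certificates (CERTIFIED #355 n = 32, #381 n = 40, #399 n = 48 at U = 8; #405 / #443 at U = 6; #430 at U = 4; #436 / #437 at U = 16 / 12 — the M1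
chain cells of record). It is `Rows/HubbardChainMPSRaw5TrNodesSrot.lean` with: raw head block `ρ₆ : Op (PolySite {-1,…,4}) 4` (coordinates
`chainWindowSixEquiv : Fin 6 ≃ {-1,…,4}`, `i ↦ i − 1`), rows E7L / E7R through `W₅ = cgMap (castTensor A) 5`, compressed levels `ω₇ … ω_N`; the
bond charges a PAIR `qb : ℕ → Fin D → ℤ × ℤ` read per bond POSITION (component 0 the additive occupation charge `cb·|occ| − ca`, component 1 the
staggered spin charge `(−1)^x·cm·([↑ ∈ occ] − [↓ ∈ occ])`, `hubbardNszbQeff`; the instance's involutive bond rule `u_b = κ − u_a − m(s)` is the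
case `(qb x a).2 = (−1)^x (2u_a − κ)`, `cm = 2`, `MPSCoarseGraining.covariantAt_of_involutive`), `ω`-tags `cgTagAt (hubbardNszbQeff cb ca cm) qb 0 (m−2)`;
and the STAGGERED-SPIN sector zeros as an extra row of both the by-value node (`ρ₆`) and the window node `LTIChainKSDNNodeSrotNszb` (the
`jw-srot` window statement with staggered sectors). Edges: `.mono`; `MPSChainKSDNRaw6TrNodeNszb.ltiChainKSDNNodeSrotNszb` (via
`Transport.ksdnSrotNszbClaim_of_mpsRaw6SrotTrClaim`); `LTIChainKSDNNodeSrotNszb.ltiChainKSDNNode` (via `Transport.ksdnClaim_of_srotNszbClaim`: the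
standard node's `(N↑, N↓)` sectors become `(N, staggered S^z)` sectors under the sublattice spin rotation — no twirl); `LTIChainKSDNNodeSrot.nszb`
(the plain `jw-srot` window node implies the one with the extra row); `.m1EnergyLowerRow`, `.m1DopedEnergyLowerRow`. No `sorry`, no new axiom, no
named fact; the nodes are `def … : Prop` taken as hypotheses by the Certificates/ instances.
[cite: KullEtAl2024, §2.5 eq. (TNfullRelax5), §3.3, §4.2 eq. (relaxLocTIn), §6.2] [cite: ArakiMoriya2003, §4.1] [cite: EsslerEtAl2005, §12.3.4]
-/

noncomputable section

open Matrix Complex Filter Topology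
open scoped ComplexOrder Kronecker BigOperators MatrixOrder
open Literature.Probability.LatticeModels
open Literature.MathematicalPhysics.QuantumLattice
open Literature.MathematicalPhysics.QuantumLattice.HubbardWave0
open Literature.MathematicalPhysics.QuantumLattice.ThermodynamicLimit
open Literature.MathematicalPhysics.QuantumLattice.JordanWigner
open Literature.MathematicalPhysics.QuantumManyBody.StateRelaxation
open Literature.MathematicalPhysics.QuantumLattice.MPSCoarseGraining
open Literature.Computability.QuantumComplexity (traceLeft traceRight)
open Summit.Ventures.CertifiedManyBodySolver.Transport

namespace Summit.Ventures.CertifiedManyBodySolver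

/-! ## §A  The coordinates of the six-site raw window and the pair charge -/

section Data

/-- **The coordinates of the six-site raw window**: `Fin 6 ≃ {-1, 0, 1, 2, 3, 4}`, `i ↦ i − 1` (the instance's raw block `rho6` sites `1…6` are the
tree's sites `-1…4`). [folklore] -/
def chainWindowSixEquiv : Fin 6 ≃ PolySite (chainWindow (-1) 4) where
  toFun i := PolySite.pt (fun _ => ((i : ℕ) : ℤ) - 1) (by
    rw [mem_chainWindow]
    have hi := i.2
    show -1 ≤ ((i : ℕ) : ℤ) - 1 ∧ ((i : ℕ) : ℤ) - 1 ≤ 4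
    omega)
  invFun y := ⟨(ofLex y.1 0 + 1).toNat, by
    have h := mem_chainWindow.1 (PolySite.ofLex_mem y)
    have h1 : ((ofLex y.1 0 + 1).toNat : ℤ) = ofLex y.1 0 + 1 := Int.toNat_of_nonneg (by omega)
    omega⟩
  left_inv i := Fin.ext (by
    show ((((i : ℕ) : ℤ) - 1) + 1).toNat = (i : ℕ)
    rw [sub_add_cancel, Int.toNat_natCast])
  right_inv y := polySite_eq_of_coord_eq (by
    have h := mem_chainWindow.1 (PolySite.ofLex_mem y)
    have h1 : ((ofLex y.1 0 + 1).toNat : ℤ) = ofLex y.1 0 + 1 := Int.toNat_of_nonneg (by omega)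
    show (((ofLex y.1 0 + 1).toNat : ℕ) : ℤ) - 1 = ofLex y.1 0
    omega)

/-- The coordinates of `chainWindowSixEquiv`: `i ↦ i − 1`. [folklore] -/
@[simp] theorem chainWindowSixEquiv_coord (i : Fin 6) : ofLex (chainWindowSixEquiv i).1 0 = ((i : ℕ) : ℤ) - 1 := rfl

/-- **The pair of site charges of the `nszb` tensors, read at bond/site POSITION `x`**: component 0 the additive occupation charge
`cb·|occ(s)| − ca` (`hubbardSrotQeff`), component 1 the staggered spin charge `(−1)^x·cm·([↑ ∈ occ s] − [↓ ∈ occ s])` (FORMAT-ksdn v0.6 R1 with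
`cm = 2`: `qs x s = (−1)^x · 2 m(s)`, `m = (0, +1, −1, 0)`). [cite: KullEtAl2024, §3.3] -/
def hubbardNszbQeff (cb ca cm : ℤ) (x : ℕ) (s : Fin 4) : ℤ × ℤ :=
  (cb * ((siteOcc s).card : ℤ) - ca,
    (-1 : ℤ) ^ x * cm * ((if (0 : Fin 2) ∈ siteOcc s then 1 else 0 : ℤ) - (if (1 : Fin 2) ∈ siteOcc s then 1 else 0 : ℤ)))

/-- Unfolding `hubbardNszbQeff`. [cite: KullEtAl2024, §3.3] -/
theorem hubbardNszbQeff_apply (cb ca cm : ℤ) (x : ℕ) (s : Fin 4) : hubbardNszbQeff cb ca cm x s =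
    (cb * ((siteOcc s).card : ℤ) - ca,
      (-1 : ℤ) ^ x * cm * ((if (0 : Fin 2) ∈ siteOcc s then 1 else 0 : ℤ) - (if (1 : Fin 2) ∈ siteOcc s then 1 else 0 : ℤ))) := rfl

/-- Component 0 of the pair charge is `hubbardSrotQeff`. [cite: KullEtAl2024, §3.3] -/
theorem hubbardNszbQeff_fst (cb ca cm : ℤ) (x : ℕ) (s : Fin 4) : (hubbardNszbQeff cb ca cm x s).1 = hubbardSrotQeff cb ca s := rfl

end Data

/-! ## §B  The node predicates (window `{-1, …, n+1}` of `N = n + 3 ≥ 7` sites, raw block `ρ₆`, bond dimension `D`, model `hubbard_jwsrot(U)`, `t = 1`) -/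

section Nodes

/-- **`jw-srot` window node WITH STAGGERED-SPIN SECTORS** (the hypothesis `hclaim` of `Transport.ksdnClaim_of_srotNszbClaim` at `t = 1` with rational
data): for every window variable `ρ : Op (PolySite {-1,…,n+1}) 4` — PSD, trace one, local translation invariance, TOTAL-OCCUPATION sector zeros,
STAGGERED-SPIN sector zeros (`Σ_y ε_y([↑ ∈ occ k_y] − [↓ ∈ occ k_y])`, `ε = −1` on odd / `+1` on even sites), total density of site `-1` equal to
`ν`, real entries, `|ρ| ≤ 1` — `lo ≤ Re tr(toSpin(U n_{-1↑}n_{-1↓} − Σ_σ (c†_{-1σ} c_{0σ̄} + c†_{0σ̄} c_{-1σ})) ρ)`. VERBATIM `LTIChainKSDNNodeSrot` plus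
the staggered row. [cite: KullEtAl2024, §4.2 eq. (relaxLocTIn), §3.3, §6.2] [cite: EsslerEtAl2005, §12.3.4] -/
def LTIChainKSDNNodeSrotNszb (U : ℝ) (n : ℕ) (ν lo : ℚ) : Prop :=
  ∀ ρ : Op (PolySite (chainWindow (-1) ((n : ℤ) + 1))) 4, ρ.PosSemidef → ρ.trace = 1 →
    spinPartialTrace ((PolySite.affEmb 1 (unitVec 0) (chainWindow (-1) (n : ℤ))).trans
        (PolySite.incl (affShiftSet_chainWindow_subset (-1) (n : ℤ)))) ρ =
      spinPartialTrace (PolySite.incl (chainWindow_mono_right (-1) (by omega : (n : ℤ) ≤ n + 1))) ρ →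
    (∀ k k' : TensorIndex (PolySite (chainWindow (-1) ((n : ℤ) + 1))) 4,
      (∑ x, (siteOcc (k x)).card) ≠ (∑ x, (siteOcc (k' x)).card) → ρ k k' = 0) →
    (∀ k k' : TensorIndex (PolySite (chainWindow (-1) ((n : ℤ) + 1))) 4,
      (∑ y : PolySite (chainWindow (-1) ((n : ℤ) + 1)), (if Odd (ofLex y.1 0) then (-1 : ℤ) else 1) *
          ((if (0 : Fin 2) ∈ siteOcc (k y) then 1 else 0 : ℤ) - (if (1 : Fin 2) ∈ siteOcc (k y) then 1 else 0 : ℤ))) ≠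
        (∑ y : PolySite (chainWindow (-1) ((n : ℤ) + 1)), (if Odd (ofLex y.1 0) then (-1 : ℤ) else 1) *
          ((if (0 : Fin 2) ∈ siteOcc (k' y) then 1 else 0 : ℤ) - (if (1 : Fin 2) ∈ siteOcc (k' y) then 1 else 0 : ℤ))) →
      ρ k k' = 0) →
    ((toSpin (nAt (-unitVec 0) (neg_unitVec_mem_chainWindow (by omega : (-1 : ℤ) ≤ n + 1)) 0 +
        nAt (-unitVec 0) (neg_unitVec_mem_chainWindow (by omega : (-1 : ℤ) ≤ n + 1)) 1) * ρ).trace).re = ((ν : ℚ) : ℝ) →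
    (∀ k k' : TensorIndex (PolySite (chainWindow (-1) ((n : ℤ) + 1))) 4, starRingEnd ℂ (ρ k k') = ρ k k') →
    (∀ k k' : TensorIndex (PolySite (chainWindow (-1) ((n : ℤ) + 1))) 4, ‖ρ k k'‖ ≤ 1) →
    ((lo : ℚ) : ℝ) ≤ ((toSpin ((U : ℂ) • (nAt (-unitVec 0) (neg_unitVec_mem_chainWindow (by omega : (-1 : ℤ) ≤ n + 1)) 0 *
          nAt (-unitVec 0) (neg_unitVec_mem_chainWindow (by omega : (-1 : ℤ) ≤ n + 1)) 1) +
        (-((1 : ℝ) : ℂ)) • ∑ σ : Fin 2,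
          ((cAt (-unitVec 0) (neg_unitVec_mem_chainWindow (by omega : (-1 : ℤ) ≤ n + 1)) σ)ᴴ *
              cAt 0 (zero_mem_chainWindow (by omega : (0 : ℤ) ≤ n + 1)) σ.rev +
            (cAt 0 (zero_mem_chainWindow (by omega : (0 : ℤ) ≤ n + 1)) σ.rev)ᴴ *
              cAt (-unitVec 0) (neg_unitVec_mem_chainWindow (by omega : (-1 : ℤ) ≤ n + 1)) σ)) * ρ).trace).re

/-- **`jw-srot` `relax = mps-rawlow(N, D, A)` node with raw block `ρ₆`, TRACE BOUNDS and STAGGERED CHARGE COMPONENTS, `ksdn-inst/1` v0.5 + v0.6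
`nszb` form** (the `hclaim` of `Transport.ksdnSrotNszbClaim_of_mpsRaw6SrotTrClaim` at `t = 1` with rational data and `qs = hubbardNszbQeff cb ca cm`):
for all variables `ρ₆ : Op (PolySite {-1,…,4}) 4` and `ω m` (`7 ≤ m ≤ n + 3`, indexed `(s_L, (a,b), s_R)`), IF `ρ₆ ⪰ 0`, `tr ρ₆ = 1`, the LTI row
`tr_{-1} ρ₆ = tr_{4} ρ₆`, the TOTAL-OCCUPATION sector zeros, the STAGGERED-SPIN sector zeros, the total density of site `-1` equal to `ν`, real
entries, `|ρ₆| ≤ 1`; rows E7L / E7R (through `chainWindowSixEquiv`, `W₅ = cgMap (castTensor A) 5`), E_mL / E_mR for `8 ≤ m ≤ n+3`; `ω_m ⪰ 0`, sector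
zeros for the site-indexed pair tags `cgTagAt (hubbardNszbQeff cb ca cm) qb 0 (m−2)`, real entries, `|ω_m| ≤ B m` AND `Re tr ω_m ≤ B m` (`7 ≤ m ≤ n+3`) —
THEN `lo ≤ Re tr(toSpin(U n_{-1↑}n_{-1↓} − Σ_σ (c†_{-1σ} c_{0σ̄} + c†_{0σ̄} c_{-1σ})) ρ₆)`. By-name audit token: predicate NAME +
`(U, n + 3 = the file's n, D, ν, lo)` + the tables `A`, `qb` (pairs per bond index AND position parity: `qb x a = (q_N(a), (−1)^x (2u_a − κ))`),
`(cb, ca, cm)`, `B m` (= `bounds.levels[m].r`, m ≥ 7). [cite: KullEtAl2024, §2.5 eq. (TNfullRelax5), §3.3, §4.2 eq. (relaxLocTIn), §6.2] -/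
def MPSChainKSDNRaw6TrNodeNszb (U : ℝ) (n D : ℕ) (A : Fin 4 → Matrix (Fin D) (Fin D) ℚ) (qb : ℕ → Fin D → ℤ × ℤ) (cb ca cm : ℤ)
    (B : ℕ → ℚ) (ν lo : ℚ) : Prop :=
  ∀ (ρ₆ : Op (PolySite (chainWindow (-1) 4)) 4)
    (ω : ℕ → Matrix (Fin 4 × ((Fin D × Fin D) × Fin 4)) (Fin 4 × ((Fin D × Fin D) × Fin 4)) ℂ),
    ρ₆.PosSemidef → ρ₆.trace = 1 →
    spinPartialTrace ((PolySite.affEmb 1 (unitVec 0) (chainWindow (-1) 3)).trans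
        (PolySite.incl affShiftSet_chainWindow_three_subset_four)) ρ₆ =
      spinPartialTrace (PolySite.incl chainWindow_three_subset_four) ρ₆ →
    (∀ k k' : TensorIndex (PolySite (chainWindow (-1) 4)) 4,
      (∑ x, (siteOcc (k x)).card) ≠ (∑ x, (siteOcc (k' x)).card) → ρ₆ k k' = 0) →
    (∀ k k' : TensorIndex (PolySite (chainWindow (-1) 4)) 4,
      (∑ y : PolySite (chainWindow (-1) 4), (if Odd (ofLex y.1 0) then (-1 : ℤ) else 1) *
          ((if (0 : Fin 2) ∈ siteOcc (k y) then 1 else 0 : ℤ) - (if (1 : Fin 2) ∈ siteOcc (k y) then 1 else 0 : ℤ))) ≠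
        (∑ y : PolySite (chainWindow (-1) 4), (if Odd (ofLex y.1 0) then (-1 : ℤ) else 1) *
          ((if (0 : Fin 2) ∈ siteOcc (k' y) then 1 else 0 : ℤ) - (if (1 : Fin 2) ∈ siteOcc (k' y) then 1 else 0 : ℤ))) →
      ρ₆ k k' = 0) →
    ((toSpin (nAt (-unitVec 0) neg_unitVec_mem_chainWindow_four 0 + nAt (-unitVec 0) neg_unitVec_mem_chainWindow_four 1) *
        ρ₆).trace).re = ((ν : ℚ) : ℝ) →
    (∀ k k' : TensorIndex (PolySite (chainWindow (-1) 4)) 4, starRingEnd ℂ (ρ₆ k k') = ρ₆ k k') →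
    (∀ k k' : TensorIndex (PolySite (chainWindow (-1) 4)) 4, ‖ρ₆ k k'‖ ≤ 1) →
    traceLeft (ω 7) = (cgMap (castTensor A) 5 ⊗ₖ (1 : Matrix (Fin 4) (Fin 4) ℂ)) *
        (ρ₆.submatrix (Equiv.arrowCongr chainWindowSixEquiv (Equiv.refl (Fin 4)))
            (Equiv.arrowCongr chainWindowSixEquiv (Equiv.refl (Fin 4)))).submatrix
          ((Equiv.prodComm _ _).trans (Fin.snocEquiv fun _ => Fin 4))
          ((Equiv.prodComm _ _).trans (Fin.snocEquiv fun _ => Fin 4)) *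
      (cgMap (castTensor A) 5 ⊗ₖ (1 : Matrix (Fin 4) (Fin 4) ℂ))ᴴ →
    traceRight ((ω 7).submatrix (Equiv.prodAssoc _ _ _) (Equiv.prodAssoc _ _ _)) =
      ((1 : Matrix (Fin 4) (Fin 4) ℂ) ⊗ₖ cgMap (castTensor A) 5) *
        (ρ₆.submatrix (Equiv.arrowCongr chainWindowSixEquiv (Equiv.refl (Fin 4)))
            (Equiv.arrowCongr chainWindowSixEquiv (Equiv.refl (Fin 4)))).submatrix
          (Fin.consEquiv fun _ => Fin 4) (Fin.consEquiv fun _ => Fin 4) *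
      ((1 : Matrix (Fin 4) (Fin 4) ℂ) ⊗ₖ cgMap (castTensor A) 5)ᴴ →
    (∀ k, k + 8 ≤ n + 3 → traceLeft (ω (k + 8)) =
      (leftMap (castTensor A) ⊗ₖ (1 : Matrix (Fin 4) (Fin 4) ℂ)) *
        (ω (k + 7)).submatrix (Equiv.prodAssoc _ _ _) (Equiv.prodAssoc _ _ _) *
      (leftMap (castTensor A) ⊗ₖ (1 : Matrix (Fin 4) (Fin 4) ℂ))ᴴ) →
    (∀ k, k + 8 ≤ n + 3 → traceRight ((ω (k + 8)).submatrix (Equiv.prodAssoc _ _ _) (Equiv.prodAssoc _ _ _)) =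
      ((1 : Matrix (Fin 4) (Fin 4) ℂ) ⊗ₖ rightMap (castTensor A)) * ω (k + 7) *
      ((1 : Matrix (Fin 4) (Fin 4) ℂ) ⊗ₖ rightMap (castTensor A))ᴴ) →
    (∀ k, k + 7 ≤ n + 3 → (ω (k + 7)).PosSemidef) →
    (∀ k, k + 7 ≤ n + 3 → ∀ i j,
      cgTagAt (hubbardNszbQeff cb ca cm) qb 0 (k + 5) i ≠ cgTagAt (hubbardNszbQeff cb ca cm) qb 0 (k + 5) j → ω (k + 7) i j = 0) →
    (∀ k, k + 7 ≤ n + 3 → ∀ i j, starRingEnd ℂ (ω (k + 7) i j) = ω (k + 7) i j) →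
    (∀ k, k + 7 ≤ n + 3 → ∀ i j, ‖ω (k + 7) i j‖ ≤ ((B (k + 7) : ℚ) : ℝ)) →
    (∀ k, k + 7 ≤ n + 3 → ((ω (k + 7)).trace).re ≤ ((B (k + 7) : ℚ) : ℝ)) →
    ((lo : ℚ) : ℝ) ≤ ((toSpin ((U : ℂ) • (nAt (-unitVec 0) neg_unitVec_mem_chainWindow_four 0 *
          nAt (-unitVec 0) neg_unitVec_mem_chainWindow_four 1) +
        (-((1 : ℝ) : ℂ)) • ∑ σ : Fin 2,
          ((cAt (-unitVec 0) neg_unitVec_mem_chainWindow_four σ)ᴴ * cAt 0 zero_mem_chainWindow_four σ.rev +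
            (cAt 0 zero_mem_chainWindow_four σ.rev)ᴴ * cAt (-unitVec 0) neg_unitVec_mem_chainWindow_four σ)) * ρ₆).trace).re

end Nodes

/-! ## §C  Solver-free edges -/

section Edges

variable {U : ℝ} {n D : ℕ} {A : Fin 4 → Matrix (Fin D) (Fin D) ℚ} {qb : ℕ → Fin D → ℤ × ℤ} {cb ca cm : ℤ} {B : ℕ → ℚ} {ν lo lo' : ℚ}

/-- A node survives a SMALLER slot `lo' ≤ lo`. -/
theorem LTIChainKSDNNodeSrotNszb.mono (h : LTIChainKSDNNodeSrotNszb U n ν lo) (hlo : lo' ≤ lo) : LTIChainKSDNNodeSrotNszb U n ν lo' :=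
  fun ρ h1 h2 h3 h4 h5 h6 h7 h8 => le_trans (by exact_mod_cast hlo) (h ρ h1 h2 h3 h4 h5 h6 h7 h8)

/-- A node survives a SMALLER slot `lo' ≤ lo`. -/
theorem MPSChainKSDNRaw6TrNodeNszb.mono (h : MPSChainKSDNRaw6TrNodeNszb U n D A qb cb ca cm B ν lo) (hlo : lo' ≤ lo) :
    MPSChainKSDNRaw6TrNodeNszb U n D A qb cb ca cm B ν lo' :=
  fun ρ₆ ω h1 h2 h3 h4 h5 h6 h7 h8 h9 h10 h11 h12 h13 h14 h15 h16 h17 =>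
    le_trans (by exact_mod_cast hlo) (h ρ₆ ω h1 h2 h3 h4 h5 h6 h7 h8 h9 h10 h11 h12 h13 h14 h15 h16 h17)

/-- **The plain `jw-srot` window node implies the one with the staggered row** (an extra hypothesis is dropped). [folklore] -/
theorem LTIChainKSDNNodeSrot.nszb (h : LTIChainKSDNNodeSrot U n ν lo) : LTIChainKSDNNodeSrotNszb U n ν lo :=
  fun ρ h1 h2 h3 h4 _ h6 h7 h8 => h ρ h1 h2 h3 h4 h6 h7 h8

/-- **THE `jw-srot`-WITH-STAGGERED-SECTORS EDGE BY NAME (window level): `LTIChainKSDNNodeSrotNszb U n ν lo → LTIChainKSDNNode U n ν lo`.**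
Solver-free: spin-flip midpoint and conjugation by the staggered product `⨂_x v_x`, under which the standard node's `(N↑, N↓)` sectors become the
`(N, staggered S^z)` sectors (`Transport.ksdnClaim_of_srotNszbClaim`). [cite: KullEtAl2024, §II.B, §3.3, §VI.B] [cite: EsslerEtAl2005, §12.3.4] -/
theorem LTIChainKSDNNodeSrotNszb.ltiChainKSDNNode (h : LTIChainKSDNNodeSrotNszb U n ν lo) : LTIChainKSDNNode U n ν lo :=
  ksdnClaim_of_srotNszbClaim 1 U n h

/-- Charge covariance of the cast tensor for the pair charge from the RATIONAL check on the table `A`. -/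
theorem mpsCovNszb_of_rat (hAcov : ∀ x s a b, A s a b ≠ 0 → qb (x + 1) b = qb x a + hubbardNszbQeff cb ca cm x s) :
    ∀ x s a b, castTensor A s a b ≠ 0 → qb (x + 1) b = qb x a + hubbardNszbQeff cb ca cm x s :=
  fun x s a b h => hAcov x s a b ((castTensor_apply_ne_zero_iff A s a b).1 h)

/-- **THE RAWLOW-`nszb` EDGE BY NAME: a `jw-srot` `mps-rawlow` (`ρ₆`, staggered charge components) certificate is a `jw-srot` window certificate
with staggered sectors** (`N = n + 3 ≥ 7`): under the side conditions (site-indexed pair-charge covariance of `A`; the `lmax_psd` rule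
`W_{m−2}ᴴW_{m−2} ≤ (B m)·𝟙`, `0 ≤ B m`, m = 7…N, over `ℂ` for `castTensor A`),
`MPSChainKSDNRaw6TrNodeNszb U n D A qb cb ca cm B ν lo → LTIChainKSDNNodeSrotNszb U n ν lo`. Solver-free: KSDN's feasible point with site-indexed
sectors (`Transport.ksdnSrotNszbClaim_of_mpsRaw6SrotTrClaim`). [cite: KullEtAl2024, §3.3, §4.2] -/
theorem MPSChainKSDNRaw6TrNodeNszb.ltiChainKSDNNodeSrotNszb (h : MPSChainKSDNRaw6TrNodeNszb U n D A qb cb ca cm B ν lo) (hn : 4 ≤ n)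
    (hAcov : ∀ x s a b, A s a b ≠ 0 → qb (x + 1) b = qb x a + hubbardNszbQeff cb ca cm x s)
    (hB : ∀ k, k + 7 ≤ n + 3 → 0 ≤ ((B (k + 7) : ℚ) : ℝ) ∧
      (cgMap (castTensor A) (k + 5))ᴴ * cgMap (castTensor A) (k + 5) ≤
        ((B (k + 7) : ℚ) : ℝ) • (1 : Matrix (Fin (k + 5) → Fin 4) (Fin (k + 5) → Fin 4) ℂ)) :
    LTIChainKSDNNodeSrotNszb U n ν lo :=
  ksdnSrotNszbClaim_of_mpsRaw6SrotTrClaim 1 U n hn (castTensor A) (star_castTensor_apply A) (hubbardNszbQeff cb ca cm) qb cb ca cm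
    (fun _ _ => rfl) (mpsCovNszb_of_rat hAcov) (fun m => ((B m : ℚ) : ℝ)) hB chainWindowSixEquiv chainWindowSixEquiv_coord h

/-- **`jw-srot` `mps-rawlow` `nszb` certificate ⇒ standard `lti(N)` certificate** (composite edge through `LTIChainKSDNNodeSrotNszb`).
[cite: KullEtAl2024, §4.2, §VI.B] -/
theorem MPSChainKSDNRaw6TrNodeNszb.ltiChainKSDNNode (h : MPSChainKSDNRaw6TrNodeNszb U n D A qb cb ca cm B ν lo) (hn : 4 ≤ n)
    (hAcov : ∀ x s a b, A s a b ≠ 0 → qb (x + 1) b = qb x a + hubbardNszbQeff cb ca cm x s)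
    (hB : ∀ k, k + 7 ≤ n + 3 → 0 ≤ ((B (k + 7) : ℚ) : ℝ) ∧
      (cgMap (castTensor A) (k + 5))ᴴ * cgMap (castTensor A) (k + 5) ≤
        ((B (k + 7) : ℚ) : ℝ) • (1 : Matrix (Fin (k + 5) → Fin 4) (Fin (k + 5) → Fin 4) ℂ)) :
    LTIChainKSDNNode U n ν lo :=
  (h.ltiChainKSDNNodeSrotNszb hn hAcov hB).ltiChainKSDNNode

end Edges

/-! ## §D  The M1 cells BY NAME -/

section Cells

variable {U : ℝ} {n D : ℕ} {A : Fin 4 → Matrix (Fin D) (Fin D) ℚ} {qb : ℕ → Fin D → ℤ × ℤ} {cb ca cm : ℤ} {B : ℕ → ℚ} {ν lo : ℚ}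
  {p q : ℕ}

/-- Window node with the staggered row at total first-site density `1` ⇒ the M1 energy LOWER row `lo ≤ e₀(U)` (`U ≥ 0`). -/
theorem LTIChainKSDNNodeSrotNszb.m1EnergyLowerRow (h : LTIChainKSDNNodeSrotNszb U n 1 lo) (hU : 0 ≤ U) : M1EnergyLowerRow U lo :=
  h.ltiChainKSDNNode.m1EnergyLowerRow hU

/-- Window node with the staggered row at density `ν = p/q` ⇒ the M1 doped energy LOWER row at filling `p/q`. -/
theorem LTIChainKSDNNodeSrotNszb.m1DopedEnergyLowerRow (h : LTIChainKSDNNodeSrotNszb U n ν lo) (hU : 0 ≤ U) (hq : 1 ≤ q)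
    (hp : p ≤ 2 * q) (hν : ((ν : ℚ) : ℝ) = (p : ℝ) / (q : ℝ)) : M1DopedEnergyLowerRow U p q lo :=
  h.ltiChainKSDNNode.m1DopedEnergyLowerRow hU hq hp hν

/-- **M1 cell BY NAME** (`ν = 1`, `U ≥ 0`): a `jw-srot` rawlow `nszb` node at half filling ⇒ `lo ≤ e₀(U)` (`M1EnergyLowerRow U lo`). -/
theorem MPSChainKSDNRaw6TrNodeNszb.m1EnergyLowerRow (h : MPSChainKSDNRaw6TrNodeNszb U n D A qb cb ca cm B 1 lo) (hn : 4 ≤ n) (hU : 0 ≤ U)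
    (hAcov : ∀ x s a b, A s a b ≠ 0 → qb (x + 1) b = qb x a + hubbardNszbQeff cb ca cm x s)
    (hB : ∀ k, k + 7 ≤ n + 3 → 0 ≤ ((B (k + 7) : ℚ) : ℝ) ∧
      (cgMap (castTensor A) (k + 5))ᴴ * cgMap (castTensor A) (k + 5) ≤
        ((B (k + 7) : ℚ) : ℝ) • (1 : Matrix (Fin (k + 5) → Fin 4) (Fin (k + 5) → Fin 4) ℂ)) :
    M1EnergyLowerRow U lo :=
  (h.ltiChainKSDNNodeSrotNszb hn hAcov hB).m1EnergyLowerRow hU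

/-- **M1 doped cell BY NAME** (`ν = p/q`, `1 ≤ q`, `p ≤ 2q`, `U ≥ 0`): `lo ≤ e₀(U, n = p/q)` (`M1DopedEnergyLowerRow U p q lo`). -/
theorem MPSChainKSDNRaw6TrNodeNszb.m1DopedEnergyLowerRow (h : MPSChainKSDNRaw6TrNodeNszb U n D A qb cb ca cm B ν lo) (hn : 4 ≤ n)
    (hU : 0 ≤ U) (hq : 1 ≤ q) (hp : p ≤ 2 * q) (hν : ((ν : ℚ) : ℝ) = (p : ℝ) / (q : ℝ))
    (hAcov : ∀ x s a b, A s a b ≠ 0 → qb (x + 1) b = qb x a + hubbardNszbQeff cb ca cm x s)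
    (hB : ∀ k, k + 7 ≤ n + 3 → 0 ≤ ((B (k + 7) : ℚ) : ℝ) ∧
      (cgMap (castTensor A) (k + 5))ᴴ * cgMap (castTensor A) (k + 5) ≤
        ((B (k + 7) : ℚ) : ℝ) • (1 : Matrix (Fin (k + 5) → Fin 4) (Fin (k + 5) → Fin 4) ℂ)) :
    M1DopedEnergyLowerRow U p q lo :=
  (h.ltiChainKSDNNodeSrotNszb hn hAcov hB).m1DopedEnergyLowerRow hU hq hp hν

end Cells

end Summit.Ventures.CertifiedManyBodySolver

end
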